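import Mathlib
import HarnessLib
import Summits.HubbardSuperconductivity.HubbardSuperconductivity.Theorems.WeakCouplingBCSKlCertDOSQuadratureIntegral
import Summits.HubbardSuperconductivity.HubbardSuperconductivity.Theorems.WeakCouplingBCSKlCertTrigReduced

/-!
# Route `WeakCouplingBCS` — crux `WcbcsBcsConstruction` (stmt-HubbardSuperconductivity-2010), stub `stub_klPointEnclosure` (Penc):
# FIRST-ORDER (tangent-model) kernel-checkable cell brackets for `∫ w_μ Φ²` and their chains

Second half of the infrastructure for the kernel-free rows E1 (`Nlo ≤ ∫ Φ² dσ_μ ≤ Nhi`, tolerance `10⁻³`) of the one-point record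
`klPtBox`/`klPtTab` (stub (Penc) of `Cruxes/WcbcsBcsConstruction/Lines/ladder_scale_certified_chain.lean`, shared with stmt-1740).  The tree's
zero-order bracket (`DOSCell.gLo/gHi`: midpoint value `∓` a global Lipschitz pad, `WeakCouplingBCSKlCertTrigQuadrature.lean`) loses `O(h)` per
unit length with constant `≈ 2·lipConst·∫w|Φ| ≈ 8.6` for the 21-term `klPt` trial (float design of this seat: gap `8.6·h`, i.e. `h ≈ 10⁻⁴`,
`≈ 7900` cells for the `10⁻³` rows) — out of reach.  Here the trial is replaced on each cell by its TANGENT MODEL at the centre `m`: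

* `cosList_remainder` — `|Φ(m+s) - Φ(m) - s Φ'(m)| ≤ K s²`, `K = remK = Σ |a_j| j² (1/2 + j η/6)` for `|s| ≤ η` (termwise
  `|cos(a+e) - cos a + e sin a| ≤ e²/2 + |e|³/6`, no calculus); `derivTrig t` tabulates `Φ'` so that `rEvalLo/rEvalHi` (reduced-argument
  evaluator of `…TrigReduced.lean`) bracket both `Φ(m)` and `Φ'(m)`;
* `integral_sq_tangent` — `∫_{m-η}^{m+η} (P + D(θ-m))² dθ = 2ηP² + (2η³/3)D²` (the cross term integrates to zero: this is what removes the
  `O(h)` loss);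
* `DOSCell.g1Lo/g1Hi` and **`DOSCell.int1_mem`** — `g1Lo ≤ ∫_cell w_μ Φ² ≤ g1Hi` for a certified cell (`DOSCell.ok`, zero-order `w`-bracket
  `wLo/wHi` of `WeakCouplingBCSKlCertDOSQuadrature.lean`) and a cos-only table: `w ∈ [wLo, wHi]`, `Φ² ∈ (P + Ds)² ± E` with
  `E = Kη²(2(|P| + |D|η) + Kη²)`;
* chains `t1LowerSum/t1UpperSum` (outward `2⁻³²` rounding) with **`t1chain_bounds`**, append lemmas, and **`quarter_t1integral_mem`**
  (`∫₀^{π/4}` from a short and a long certified chain) — same interface as the zero-order `quarter_tintegral_mem`.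

Float design (this seat, `eng/sim_e1b.py`): with the tangent model the remaining loss is the `w`-bracket, gap `≈ 0.74·h` on the full circle, so
`h = 10⁻³` (≈ 800 cells on `[0, 201/256]`) certifies `[0.999, 1.001]` around `N = 0.99999`.  Everything is proved; definitions are finite rational
expressions.  Honest framing: quadrature soundness only; no enclosure of the record is claimed in this file; nothing about a channel order,
`U₀` or superconductivity in the Hubbard model. [folklore]
-/

noncomputable section

-- the tree's namespace `Summit.<Summit>.<Problem>.Theorems` repeats the summit name by design (D-0017)
set_option linter.dupNamespace false

namespace Summit.HubbardSuperconductivity.HubbardSuperconductivity.Theorems.KlCertQuad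

open Real Set MeasureTheory intervalIntegral CwKLChiralWindow Literature.MathematicalPhysics.QuantumLattice

/-! ### The formal derivative and the second-order remainder of a cosine table -/

/-- `Φ'(m) = -Σ a_j j sin(j m)` — the formal derivative of a cosine coefficient list at `m`. [folklore] -/
def cosListDeriv (L : List (ℕ × ℚ)) (m : ℝ) : ℝ :=
  (L.map fun p : ℕ × ℚ => -((p.2 : ℝ) * (p.1 : ℝ) * Real.sin ((p.1 : ℝ) * m))).sum

/-- The derivative table of the cosine part of `t`: sines with coefficients `-a_j j` (so that `rEvalLo/rEvalHi` bracket `Φ'`). [folklore] -/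
def derivTrig (t : KLTrig) : KLTrig := ⟨[], t.cosC.map fun p => (p.1, -(p.2 * p.1))⟩

/-- `(derivTrig t).eval m = Φ'(m)`. [folklore] -/
theorem derivTrig_eval (t : KLTrig) (m : ℝ) : (derivTrig t).eval m = cosListDeriv t.cosC m := by
  rw [KLTrig.eval, derivTrig, cosListDeriv]
  simp only [List.map_nil, List.sum_nil, zero_add, List.map_map]
  congr 1
  apply List.map_congr_left
  intro p _
  simp only [Function.comp_apply]
  push_cast; ring

/-- The remainder constant `K(L, η) = Σ |a_j| j² (1/2 + j η / 6)` of the tangent model on a cell of half-width `η`. [folklore] -/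
def remK (L : List (ℕ × ℚ)) (η : ℚ) : ℚ :=
  (L.map fun p : ℕ × ℚ => |p.2| * (p.1 : ℚ) ^ 2 * (1 / 2 + (p.1 : ℚ) * η / 6)).sum

/-- `0 ≤ K(L, η)` for `η ≥ 0`. [folklore] -/
theorem remK_nonneg (L : List (ℕ × ℚ)) {η : ℚ} (hη : 0 ≤ η) : 0 ≤ remK L η := by
  induction L with
  | nil => simp [remK]
  | cons p L ih =>
    simp only [remK, List.map_cons, List.sum_cons] at ih ⊢
    have : 0 ≤ |p.2| * (p.1 : ℚ) ^ 2 * (1 / 2 + (p.1 : ℚ) * η / 6) := by positivity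
    linarith

/-- Termwise tangent remainder: `|cos(a + e) - cos a + e sin a| ≤ e²/2 + |e|³/6`. [folklore] -/
theorem abs_cos_add_sub_le (a e : ℝ) : |Real.cos (a + e) - Real.cos a + e * Real.sin a| ≤ e ^ 2 / 2 + |e| ^ 3 / 6 := by
  have hid : Real.cos (a + e) - Real.cos a + e * Real.sin a =
      Real.cos a * (Real.cos e - 1) - Real.sin a * (Real.sin e - e) := by
    rw [Real.cos_add]; ring
  rw [hid]
  have hc1 : |Real.cos e - 1| ≤ e ^ 2 / 2 := by
    rw [abs_le]; constructor <;> nlinarith [Real.one_sub_sq_div_two_le_cos (x := e), Real.cos_le_one e]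
  have hs1 : |Real.sin e - e| ≤ |e| ^ 3 / 6 := by rw [abs_sub_comm]; exact Real.abs_sub_sin_le e
  calc |Real.cos a * (Real.cos e - 1) - Real.sin a * (Real.sin e - e)|
      ≤ |Real.cos a * (Real.cos e - 1)| + |Real.sin a * (Real.sin e - e)| := abs_sub _ _
    _ = |Real.cos a| * |Real.cos e - 1| + |Real.sin a| * |Real.sin e - e| := by rw [abs_mul, abs_mul]
    _ ≤ 1 * |Real.cos e - 1| + 1 * |Real.sin e - e| := by
        gcongr
        · exact Real.abs_cos_le_one a
        · exact Real.abs_sin_le_one a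
    _ ≤ e ^ 2 / 2 + |e| ^ 3 / 6 := by linarith

/-- **Tangent-model remainder of a cosine table**: for `|s| ≤ η`,
`|Σ a_j cos(j(m+s)) - Σ a_j cos(j m) - s·Φ'(m)| ≤ K(L, η) s²`. [folklore] -/
theorem cosList_remainder (L : List (ℕ × ℚ)) {η : ℚ} {m s : ℝ} (hs : |s| ≤ η) :
    |(L.map fun p : ℕ × ℚ => (p.2 : ℝ) * Real.cos ((p.1 : ℝ) * (m + s))).sum -
        (L.map fun p : ℕ × ℚ => (p.2 : ℝ) * Real.cos ((p.1 : ℝ) * m)).sum - s * cosListDeriv L m| ≤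
      ((remK L η : ℚ) : ℝ) * s ^ 2 := by
  induction L with
  | nil => simp [remK, cosListDeriv]
  | cons p L ih =>
    simp only [List.map_cons, List.sum_cons, cosListDeriv, remK, Rat.cast_add] at ih ⊢
    have hterm : |(p.2 : ℝ) * Real.cos ((p.1 : ℝ) * (m + s)) - (p.2 : ℝ) * Real.cos ((p.1 : ℝ) * m) -
        s * -((p.2 : ℝ) * (p.1 : ℝ) * Real.sin ((p.1 : ℝ) * m))| ≤
        ((|p.2| * (p.1 : ℚ) ^ 2 * (1 / 2 + (p.1 : ℚ) * η / 6) : ℚ) : ℝ) * s ^ 2 := by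
      have h := abs_cos_add_sub_le ((p.1 : ℝ) * m) ((p.1 : ℝ) * s)
      have hid : (p.2 : ℝ) * Real.cos ((p.1 : ℝ) * (m + s)) - (p.2 : ℝ) * Real.cos ((p.1 : ℝ) * m) -
          s * -((p.2 : ℝ) * (p.1 : ℝ) * Real.sin ((p.1 : ℝ) * m)) =
          (p.2 : ℝ) * (Real.cos ((p.1 : ℝ) * m + (p.1 : ℝ) * s) - Real.cos ((p.1 : ℝ) * m) +
            ((p.1 : ℝ) * s) * Real.sin ((p.1 : ℝ) * m)) := by rw [mul_add]; ring
      rw [hid, abs_mul]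
      have hj : (0 : ℝ) ≤ (p.1 : ℝ) := Nat.cast_nonneg _
      have hs0 : 0 ≤ |s| := abs_nonneg _
      have hη : |s| ≤ ((η : ℚ) : ℝ) := hs
      have hss : s ^ 2 = |s| ^ 2 := (sq_abs s).symm
      have h3 : |(p.1 : ℝ) * s| ^ 3 = (p.1 : ℝ) ^ 3 * (|s| ^ 2 * |s|) := by
        rw [abs_mul, abs_of_nonneg hj]; ring
      have hbound : ((p.1 : ℝ) * s) ^ 2 / 2 + |(p.1 : ℝ) * s| ^ 3 / 6 ≤
          (p.1 : ℝ) ^ 2 * (1 / 2 + (p.1 : ℝ) * η / 6) * s ^ 2 := by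
        rw [h3, mul_pow, hss]
        have : (p.1 : ℝ) ^ 3 * (|s| ^ 2 * |s|) ≤ (p.1 : ℝ) ^ 3 * (|s| ^ 2 * η) := by
          apply mul_le_mul_of_nonneg_left _ (by positivity)
          exact mul_le_mul_of_nonneg_left hη (by positivity)
        nlinarith
      push_cast
      calc |(p.2 : ℝ)| * |Real.cos ((p.1 : ℝ) * m + (p.1 : ℝ) * s) - Real.cos ((p.1 : ℝ) * m) +
              (p.1 : ℝ) * s * Real.sin ((p.1 : ℝ) * m)|
          ≤ |(p.2 : ℝ)| * (((p.1 : ℝ) * s) ^ 2 / 2 + |(p.1 : ℝ) * s| ^ 3 / 6) :=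
            mul_le_mul_of_nonneg_left h (abs_nonneg _)
        _ ≤ |(p.2 : ℝ)| * ((p.1 : ℝ) ^ 2 * (1 / 2 + (p.1 : ℝ) * η / 6) * s ^ 2) :=
            mul_le_mul_of_nonneg_left hbound (abs_nonneg _)
        _ = |(p.2 : ℝ)| * (p.1 : ℝ) ^ 2 * (1 / 2 + (p.1 : ℝ) * η / 6) * s ^ 2 := by ring
    have hsplit : ∀ (A B C A' B' C' : ℝ), A + A' - (B + B') - s * (C + C') = (A - B - s * C) + (A' - B' - s * C') := by
      intros; ring
    rw [hsplit]
    refine (abs_add_le _ _).trans ?_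
    push_cast at hterm ih ⊢
    linarith [hterm, ih]

/-- The cos-only trigonometric table evaluates to its cosine list. [folklore] -/
theorem eval_of_cosOnly (t : KLTrig) (ht : t.sinC = []) (θ : ℝ) :
    t.eval θ = (t.cosC.map fun p : ℕ × ℚ => (p.2 : ℝ) * Real.cos ((p.1 : ℝ) * θ)).sum := by
  rw [KLTrig.eval, ht]; simp

/-! ### The exact integral of the squared tangent model -/

/-- `∫_{m-η}^{m+η} (P + D(θ - m))² dθ = 2η P² + (2η³/3) D²`. [folklore] -/
theorem integral_sq_tangent (P D m η : ℝ) :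
    ∫ θ in (m - η)..(m + η), (P + D * (θ - m)) ^ 2 = 2 * η * P ^ 2 + 2 * η ^ 3 / 3 * D ^ 2 := by
  have hsub := intervalIntegral.integral_comp_sub_right (fun u : ℝ => (P + D * u) ^ 2) m (a := m - η) (b := m + η)
  simp only [sub_sub_cancel_left, add_sub_cancel_left] at hsub
  rw [hsub]
  have hexp : (fun u : ℝ => (P + D * u) ^ 2) = fun u : ℝ => P ^ 2 + ((2 * P * D) * u + D ^ 2 * u ^ 2) := by
    ext u; ring
  rw [hexp]
  have hI : ∀ g : ℝ → ℝ, Continuous g → IntervalIntegrable g MeasureTheory.volume (-η) η :=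
    fun g hg => hg.intervalIntegrable _ _
  rw [intervalIntegral.integral_add (hI _ continuous_const) (hI _ (by fun_prop)),
    intervalIntegral.integral_add (hI _ (by fun_prop)) (hI _ (by fun_prop)),
    intervalIntegral.integral_const, intervalIntegral.integral_const_mul, intervalIntegral.integral_const_mul,
    integral_id, integral_pow]
  simp only [smul_eq_mul]
  ring

/-! ### Generic rational brackets -/

/-- Lower bracket of `x²` for `x ∈ [lo, hi]`. [folklore] -/
def sqBrLo (lo hi : ℚ) : ℚ := if lo ≤ 0 ∧ 0 ≤ hi then 0 else min (lo ^ 2) (hi ^ 2)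
/-- Upper bracket of `x²` for `x ∈ [lo, hi]`. [folklore] -/
def sqBrHi (lo hi : ℚ) : ℚ := max (lo ^ 2) (hi ^ 2)
/-- Bracket of `|x|` for `x ∈ [lo, hi]`. [folklore] -/
def absBr (lo hi : ℚ) : ℚ := max |lo| |hi|

/-- Soundness of `sqBrLo` / `sqBrHi` / `absBr`. [folklore] -/
theorem sqBr_mem {lo hi : ℚ} {x : ℝ} (h₁ : ((lo : ℚ) : ℝ) ≤ x) (h₂ : x ≤ ((hi : ℚ) : ℝ)) :
    ((sqBrLo lo hi : ℚ) : ℝ) ≤ x ^ 2 ∧ x ^ 2 ≤ ((sqBrHi lo hi : ℚ) : ℝ) ∧ |x| ≤ ((absBr lo hi : ℚ) : ℝ) := by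
  refine ⟨?_, ?_, ?_⟩
  · unfold sqBrLo
    split_ifs with h
    · push_cast; positivity
    · push_cast
      rw [not_and_or, not_le, not_le] at h
      rcases h with h | h
      · have hL : (0 : ℝ) < lo := by exact_mod_cast h
        exact (min_le_left _ _).trans (by nlinarith)
      · have hH : ((hi : ℚ) : ℝ) < 0 := by exact_mod_cast h
        exact (min_le_right _ _).trans (by nlinarith)
  · rw [sqBrHi]; push_cast
    rcases le_total 0 x with hx | hx
    · exact le_trans (by nlinarith) (le_max_right _ _)
    · exact le_trans (by nlinarith) (le_max_left _ _)
  · rw [absBr]; push_cast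
    rcases le_total 0 x with hx | hx
    · rw [abs_of_nonneg hx]; exact le_trans (h₂.trans (le_abs_self _)) (le_max_right _ _)
    · rw [abs_of_nonpos hx]; exact le_trans (by linarith [neg_abs_le (lo : ℝ)]) (le_max_left _ _)

/-! ### The tangent-model cell bracket -/

namespace DOSCell

variable (c : DOSCell) (t : KLTrig)

/-- Centre of the cell. [folklore] -/
def ctr : ℚ := (c.a + c.b) / 2
/-- Half-width of the cell. [folklore] -/
def hw : ℚ := (c.b - c.a) / 2
/-- Bracket of `Φ(ctr)`: lower. [folklore] -/
def p1Lo : ℚ := rEvalLo t c.ctr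
/-- Bracket of `Φ(ctr)`: upper. [folklore] -/
def p1Hi : ℚ := rEvalHi t c.ctr
/-- Bracket of `Φ'(ctr)`: lower. [folklore] -/
def d1Lo : ℚ := rEvalLo (derivTrig t) c.ctr
/-- Bracket of `Φ'(ctr)`: upper. [folklore] -/
def d1Hi : ℚ := rEvalHi (derivTrig t) c.ctr
/-- Uniform bound of `|Φ² - (tangent model)²|` on the cell. [folklore] -/
def err1 : ℚ :=
  remK t.cosC c.hw * c.hw ^ 2 *
    (2 * (absBr (c.p1Lo t) (c.p1Hi t) + absBr (c.d1Lo t) (c.d1Hi t) * c.hw) + remK t.cosC c.hw * c.hw ^ 2)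
/-- Lower bracket of `∫_cell Φ²`. [folklore] -/
def j1Lo : ℚ :=
  (c.b - c.a) * (sqBrLo (c.p1Lo t) (c.p1Hi t) + sqBrLo (c.d1Lo t) (c.d1Hi t) * c.hw ^ 2 / 3 - c.err1 t)
/-- Upper bracket of `∫_cell Φ²`. [folklore] -/
def j1Hi : ℚ :=
  (c.b - c.a) * (sqBrHi (c.p1Lo t) (c.p1Hi t) + sqBrHi (c.d1Lo t) (c.d1Hi t) * c.hw ^ 2 / 3 + c.err1 t)
/-- **Lower bracket of `∫_cell w_μ Φ²`** (tangent model for `Φ`, zero-order bracket for `w_μ`). [folklore] -/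
def g1Lo : ℚ := c.wLo * c.j1Lo t
/-- **Upper bracket of `∫_cell w_μ Φ²`.** [folklore] -/
def g1Hi : ℚ := c.wHi * c.j1Hi t

end DOSCell

section CellSound

variable {μq : ℚ} (hμ₁ : -4 < ((μq : ℚ) : ℝ)) (hμ₂ : ((μq : ℚ) : ℝ) < 0) {c : DOSCell} (hc : c.ok μq = true)
  (t : KLTrig) (ht : t.sinC = [])
include hμ₁ hμ₂ hc ht

/-- **Soundness of the tangent-model cell bracket**: `g1Lo ≤ ∫_a^b w_μ Φ² ≤ g1Hi` for a certified cell and a cos-only table. [folklore] -/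
theorem DOSCell.int1_mem :
    ((c.g1Lo t : ℚ) : ℝ) ≤ ∫ θ in ((c.a : ℚ) : ℝ)..((c.b : ℚ) : ℝ), fermiPolarDOS (μq : ℝ) θ * t.eval θ ^ 2 ∧
      ∫ θ in ((c.a : ℚ) : ℝ)..((c.b : ℚ) : ℝ), fermiPolarDOS (μq : ℝ) θ * t.eval θ ^ 2 ≤ ((c.g1Hi t : ℚ) : ℝ) := by
  obtain ⟨⟨ha0, hab, -⟩, -, ⟨hulo0, hlohi, -⟩, -, -, ⟨-, -, hDt0⟩⟩ := DOSCell.ok_spec hc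
  -- geometry
  set m : ℝ := ((c.ctr : ℚ) : ℝ) with hm
  set η : ℝ := ((c.hw : ℚ) : ℝ) with hη
  have hm' : m = (((c.a : ℚ) : ℝ) + c.b) / 2 := by rw [hm, DOSCell.ctr]; push_cast; ring
  have hη' : η = (((c.b : ℚ) : ℝ) - c.a) / 2 := by rw [hη, DOSCell.hw]; push_cast; ring
  have hab' : ((c.a : ℚ) : ℝ) ≤ c.b := by exact_mod_cast hab
  have hη0 : 0 ≤ η := by rw [hη']; linarith
  have hηq : (0 : ℚ) ≤ c.hw := by rw [DOSCell.hw]; linarith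
  have hm0 : (0 : ℚ) ≤ c.ctr := by rw [DOSCell.ctr]; linarith
  have ha_eq : ((c.a : ℚ) : ℝ) = m - η := by rw [hm', hη']; ring
  have hb_eq : ((c.b : ℚ) : ℝ) = m + η := by rw [hm', hη']; ring
  -- the tangent data and their enclosures
  set P : ℝ := t.eval m
  set D : ℝ := cosListDeriv t.cosC m
  have hP : ((c.p1Lo t : ℚ) : ℝ) ≤ P ∧ P ≤ ((c.p1Hi t : ℚ) : ℝ) := ⟨rEvalLo_le t hm0, le_rEvalHi t hm0⟩
  have hD : ((c.d1Lo t : ℚ) : ℝ) ≤ D ∧ D ≤ ((c.d1Hi t : ℚ) : ℝ) := by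
    have h₁ := rEvalLo_le (derivTrig t) hm0
    have h₂ := le_rEvalHi (derivTrig t) hm0
    rw [derivTrig_eval] at h₁ h₂
    exact ⟨h₁, h₂⟩
  obtain ⟨hP1, hP2, hPa⟩ := sqBr_mem hP.1 hP.2
  obtain ⟨hD1, hD2, hDa⟩ := sqBr_mem hD.1 hD.2
  have hK0 : (0 : ℝ) ≤ ((remK t.cosC c.hw : ℚ) : ℝ) := by exact_mod_cast remK_nonneg t.cosC hηq
  set K : ℝ := ((remK t.cosC c.hw : ℚ) : ℝ)
  -- the uniform model error on the cell
  set E : ℝ := ((c.err1 t : ℚ) : ℝ)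
  have hE : E = K * η ^ 2 * (2 * (((absBr (c.p1Lo t) (c.p1Hi t) : ℚ) : ℝ) +
      ((absBr (c.d1Lo t) (c.d1Hi t) : ℚ) : ℝ) * η) + K * η ^ 2) := by
    simp only [E, K, η, DOSCell.err1]; push_cast; ring
  have hpt : ∀ θ, ((c.a : ℚ) : ℝ) ≤ θ → θ ≤ ((c.b : ℚ) : ℝ) →
      |t.eval θ ^ 2 - (P + D * (θ - m)) ^ 2| ≤ E := by
    intro θ h1 h2
    set s := θ - m
    have hs : |s| ≤ ((c.hw : ℚ) : ℝ) := by
      rw [abs_le]; constructor <;> [linarith [ha_eq]; linarith [hb_eq]]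
    have hrem := cosList_remainder t.cosC (m := m) hs
    rw [← eval_of_cosOnly t ht, show m + s = θ by ring, ← eval_of_cosOnly t ht] at hrem
    set R := t.eval θ - P - s * D
    have hR : |R| ≤ K * η ^ 2 := by
      refine hrem.trans ?_
      have : s ^ 2 ≤ η ^ 2 := by rw [← sq_abs]; exact pow_le_pow_left₀ (abs_nonneg _) hs 2
      exact mul_le_mul_of_nonneg_left this hK0
    have hid : t.eval θ ^ 2 - (P + D * s) ^ 2 = R * (2 * (P + D * s) + R) := by ring
    rw [hid, abs_mul]
    have h2 : |2 * (P + D * s) + R| ≤ 2 * (((absBr (c.p1Lo t) (c.p1Hi t) : ℚ) : ℝ) +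
        ((absBr (c.d1Lo t) (c.d1Hi t) : ℚ) : ℝ) * η) + K * η ^ 2 := by
      refine (abs_add_le _ _).trans ?_
      rw [abs_mul, abs_two]
      have : |P + D * s| ≤ ((absBr (c.p1Lo t) (c.p1Hi t) : ℚ) : ℝ) + ((absBr (c.d1Lo t) (c.d1Hi t) : ℚ) : ℝ) * η := by
        refine (abs_add_le _ _).trans ?_
        rw [abs_mul]
        nlinarith [mul_le_mul hDa hs (abs_nonneg _) ((abs_nonneg _).trans hDa), abs_nonneg D, abs_nonneg s]
      linarith
    rw [hE]
    calc |R| * |2 * (P + D * s) + R| ≤ (K * η ^ 2) * (2 * (((absBr (c.p1Lo t) (c.p1Hi t) : ℚ) : ℝ) +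
        ((absBr (c.d1Lo t) (c.d1Hi t) : ℚ) : ℝ) * η) + K * η ^ 2) :=
          mul_le_mul hR h2 (abs_nonneg _) (by positivity)
      _ = _ := by ring
  -- integrability
  have hcw := continuous_fermiPolarDOS hμ₁ hμ₂
  have hce := kl_tr_continuous_eval t
  have hIg : IntervalIntegrable (fun θ => fermiPolarDOS (μq : ℝ) θ * t.eval θ ^ 2) MeasureTheory.volume
      ((c.a : ℚ) : ℝ) ((c.b : ℚ) : ℝ) := (hcw.mul (hce.pow 2)).intervalIntegrable _ _
  have hIq : ∀ C₁ C₂ : ℝ, IntervalIntegrable (fun θ => C₁ * ((P + D * (θ - m)) ^ 2 + C₂)) MeasureTheory.volume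
      ((c.a : ℚ) : ℝ) ((c.b : ℚ) : ℝ) := fun C₁ C₂ => (by fun_prop : Continuous _).intervalIntegrable _ _
  have hquad : ∀ C₁ C₂ : ℝ, ∫ θ in ((c.a : ℚ) : ℝ)..((c.b : ℚ) : ℝ), C₁ * ((P + D * (θ - m)) ^ 2 + C₂) =
      C₁ * ((((c.b : ℚ) : ℝ) - c.a) * (P ^ 2 + D ^ 2 * η ^ 2 / 3 + C₂)) := by
    intro C₁ C₂
    rw [intervalIntegral.integral_const_mul, intervalIntegral.integral_add ((by fun_prop : Continuous _).intervalIntegrable _ _)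
      intervalIntegrable_const, intervalIntegral.integral_const, ha_eq, hb_eq, integral_sq_tangent, smul_eq_mul]
    ring
  -- the `w` bracket
  have hw : ∀ θ, ((c.a : ℚ) : ℝ) ≤ θ → θ ≤ ((c.b : ℚ) : ℝ) →
      ((c.wLo : ℚ) : ℝ) ≤ fermiPolarDOS (μq : ℝ) θ ∧ fermiPolarDOS (μq : ℝ) θ ≤ ((c.wHi : ℚ) : ℝ) :=
    fun θ h1 h2 => DOSCell.dos_mem hμ₁ hμ₂ hc h1 h2
  have hwLo0 : (0 : ℝ) ≤ ((c.wLo : ℚ) : ℝ) := by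
    have h1 : (0 : ℚ) < c.DtLo := hDt0
    have : (0 : ℚ) ≤ c.wLo := by
      rw [DOSCell.wLo]
      have hhi : c.DtLo ≤ c.DtHi := by
        have := (DOSCell.Dt_mem hμ₁ hμ₂ hc (le_of_eq rfl) hab' : _)
        exact_mod_cast this.1.trans this.2
      exact div_nonneg hulo0.le (h1.le.trans hhi)
    exact_mod_cast this
  constructor
  · -- lower: `wLo · ((P + Ds)² - E) ≤ w Φ²`
    have hmono := intervalIntegral.integral_mono_on hab' (hIq ((c.wLo : ℚ) : ℝ) (-E)) hIg (fun θ hθ => by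
      obtain ⟨hw1, -⟩ := hw θ hθ.1 hθ.2
      have hsq := hpt θ hθ.1 hθ.2
      rw [abs_le] at hsq
      have hΦ0 : 0 ≤ t.eval θ ^ 2 := sq_nonneg _
      calc ((c.wLo : ℚ) : ℝ) * ((P + D * (θ - m)) ^ 2 + -E) ≤ ((c.wLo : ℚ) : ℝ) * t.eval θ ^ 2 :=
            mul_le_mul_of_nonneg_left (by linarith) hwLo0
        _ ≤ fermiPolarDOS (μq : ℝ) θ * t.eval θ ^ 2 := mul_le_mul_of_nonneg_right hw1 hΦ0)
    rw [hquad] at hmono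
    refine le_trans ?_ hmono
    rw [DOSCell.g1Lo, DOSCell.j1Lo]; push_cast
    refine mul_le_mul_of_nonneg_left ?_ hwLo0
    refine mul_le_mul_of_nonneg_left ?_ (by linarith)
    have : ((sqBrLo (c.d1Lo t) (c.d1Hi t) : ℚ) : ℝ) * η ^ 2 / 3 ≤ D ^ 2 * η ^ 2 / 3 := by
      have := mul_le_mul_of_nonneg_right hD1 (sq_nonneg η); linarith
    simp only [η] at this; linarith
  · -- upper: `w Φ² ≤ wHi · ((P + Ds)² + E)`
    have hmono := intervalIntegral.integral_mono_on hab' hIg (hIq ((c.wHi : ℚ) : ℝ) E) (fun θ hθ => by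
      obtain ⟨hw1, hw2⟩ := hw θ hθ.1 hθ.2
      have hsq := hpt θ hθ.1 hθ.2
      rw [abs_le] at hsq
      have hΦ0 : 0 ≤ t.eval θ ^ 2 := sq_nonneg _
      calc fermiPolarDOS (μq : ℝ) θ * t.eval θ ^ 2 ≤ ((c.wHi : ℚ) : ℝ) * t.eval θ ^ 2 :=
            mul_le_mul_of_nonneg_right hw2 hΦ0
        _ ≤ ((c.wHi : ℚ) : ℝ) * ((P + D * (θ - m)) ^ 2 + E) :=
            mul_le_mul_of_nonneg_left (by linarith) (hwLo0.trans (hw1.trans hw2)))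
    rw [hquad] at hmono
    refine hmono.trans ?_
    have hwHi0 : (0 : ℝ) ≤ ((c.wHi : ℚ) : ℝ) := by
      obtain ⟨hw1, hw2⟩ := hw _ le_rfl hab'
      exact hwLo0.trans (hw1.trans hw2)
    rw [DOSCell.g1Hi, DOSCell.j1Hi]; push_cast
    refine mul_le_mul_of_nonneg_left ?_ hwHi0
    refine mul_le_mul_of_nonneg_left ?_ (by linarith)
    have : D ^ 2 * η ^ 2 / 3 ≤ ((sqBrHi (c.d1Lo t) (c.d1Hi t) : ℚ) : ℝ) * η ^ 2 / 3 := by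
      have := mul_le_mul_of_nonneg_right hD2 (sq_nonneg η); linarith
    simp only [η] at this; linarith

end CellSound

end Summit.HubbardSuperconductivity.HubbardSuperconductivity.Theorems.KlCertQuad

end
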